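import Mathlib
import HarnessLib
import Literature.MathematicalPhysics.QuantumLattice.ReducedBCSTorus
import Literature.MathematicalPhysics.QuantumLattice.TorusCooperSumLogBound

/-!
# Route `WeakCouplingBCS` — crux `WcbcsBcsConstruction` (stmt-HubbardSuperconductivity-2010),
# line `lro-seed-kink-bridge`, stub `stub_dWaveCooperSumLowerBound`

**The `d`-wave-weighted zero-temperature Cooper logarithm on the torus.** For chemical potentials in a
compact `[μ₁, μ₂] ⊂ (-4, 0)` there are `c, h₀ > 0` such that for every `h ∈ (0, h₀)` and
`μ ∈ [μ₁, μ₂]`, eventually in `L`,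

`Σ_{k ∈ (ℤ/Lℤ)²} ĝ_d(k)² / √((ε_L(k) - μ)² + h²) ≥ c · log(1/h) · L²`,

where `ε_L(k) = -2cos(2πk₁/L) - 2cos(2πk₂/L)` (`torusBand`) and `ĝ_d(k) = cos(2πk₁/L) - cos(2πk₂/L)`
(`dWaveGap`). This is the finite-torus, `h`-regulated, `d`-wave-weighted form of the Cooper logarithm
`½N(0) log(1/h)` of the free band (Salmhofer, *Renormalization* (1999), §4.5.4).

## Proof (row walk, all terms are `≥ 0`)

Put `κ = (4 + μ₁)/8 ∈ (0, ½]`. Only the rows `k₂ = b` with `2πb/L ≤ κ` are kept (there are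
`≥ κL/(2π)` of them); on such a row `cos(2πb/L) ≥ 1 - κ`, so the row crosses the Fermi level `ε = μ`
transversally (`|2cos(2πb/L) + μ| ≤ 2 - s²/2` for the explicit small parameter
`s = κ(-μ₂)/4`), and at every momentum of the row with `ε ≥ μ` the form factor satisfies
`ĝ_d = -2cos(2πb/L) - μ/2 - (ε - μ)/2 ≤ -2κ`, i.e. `ĝ_d² ≥ 4κ²` (the antinodal region near `(π - k_F, 0)`).
Along the row, to the right of the crossing `n₀` the energies `ξ_j = ε(n₀ + j) - μ`, `0 ≤ j ≤ R ≈ s²L/64`,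
satisfy `0 ≤ ξ_j ≤ 4π(j+1)/L` (`cooperRow_walk_bounds` of `TorusCooperSumRowWalk`), hence
`1/√(ξ_j² + h²) ≥ 1/(ξ_j + h) ≥ L/(4π(j + 1 + A))` with `A = ⌈hL/(4π)⌉`, and the harmonic sum
`Σ_{j ≤ R} 1/(j + 1 + A) ≥ log((R + 2 + A)/(A + 1)) ≥ log(πs²/(32h)) ≥ ½ log(1/h)` once `L ≥ 8π/h` and
`h < (πs²/32)²`. Summing: each kept row carries `κ²L log(1/h)/(2π)`, and the total is
`≥ κ³ L² log(1/h)/(4π²)`. Constants are not optimised.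
-/

noncomputable section

set_option linter.dupNamespace false

namespace Summit.HubbardSuperconductivity.HubbardSuperconductivity.Theorems

open Literature.MathematicalPhysics.QuantumLattice Literature.Probability.LatticeModels Matrix Filter
open scoped Matrix.Norms.L2Operator ComplexOrder Topology

open Real Finset

/-! ### One row: the `h`-regulated weighted harmonic walk -/

/-- **The weighted `h`-regulated harmonic walk along one row.** For row energies
`g(n) = -2cos(2πn/L) + c` with `|c| ≤ 2 - s²/2` (`0 < s ≤ 1`, `L ≥ 400/s²`), a regulator
`0 < h < (πs²/32)²` with `L ≥ 8π/h`, and weights with `w(n)² ≥ 4κ²` wherever `g(n) ≥ 0`, one has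
`Σ_{n < L} w(n)²/√(g(n)² + h²) ≥ κ²L log(1/h)/(2π)`: to the right of the crossing the energies
`g(n₀ + j)`, `j ≤ R ≈ s²L/64`, lie in `[0, 4π(j+1)/L]`, and `Σ_j 1/(j + 1 + hL/(4π)) ≳ log(1/h)`.
[cite: Salmhofer1999, §4.5.4] -/
theorem dWaveCooperRow_sum_ge {L : ℕ} {s c h κ : ℝ} (g w : ℕ → ℝ)
    (hg : ∀ n : ℕ, g n = -2 * Real.cos (2 * π * (n : ℝ) / L) + c) (hs : 0 < s) (hs1 : s ≤ 1)
    (hc : |c| ≤ 2 - s ^ 2 / 2) (hL : 400 / s ^ 2 ≤ (L : ℝ)) (hh : 0 < h)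
    (hhq : h < (π * s ^ 2 / 32) ^ 2) (hLh : 8 * π / h ≤ (L : ℝ))
    (hw : ∀ n, 0 ≤ g n → 4 * κ ^ 2 ≤ (w n) ^ 2) :
    κ ^ 2 * L / (2 * π) * Real.log (1 / h) ≤
      ∑ n ∈ Finset.range L, (w n) ^ 2 / Real.sqrt ((g n) ^ 2 + h ^ 2) := by
  have hπ := Real.pi_pos
  have hs2 : 0 < s ^ 2 := by positivity
  have hsL : 400 ≤ s ^ 2 * L := by rwa [div_le_iff₀ hs2, mul_comm] at hL
  have hLr : (0 : ℝ) < L := by nlinarith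
  obtain ⟨n₀, _, hn₀L, hg0, hg1, hcos⟩ := exists_cooperRow_crossing hs hs1 hc hL
  -- the length of the walk and the integer form of the regulator
  set R : ℕ := ⌊s ^ 2 * L / 64⌋₊ with hR
  have hRle : (R : ℝ) ≤ s ^ 2 * L / 64 := Nat.floor_le (by positivity)
  have hRge : s ^ 2 * L / 64 < R + 1 := Nat.lt_floor_add_one _
  set A : ℕ := ⌈h * L / (4 * π)⌉₊ with hA
  have hAge : h * L / (4 * π) ≤ A := Nat.le_ceil _
  have hAlt : (A : ℝ) < h * L / (4 * π) + 1 := Nat.ceil_lt_add_one (by positivity)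
  have hhL : 2 ≤ h * L / (4 * π) := by
    rw [le_div_iff₀ (by positivity)]
    rw [div_le_iff₀ hh] at hLh
    linarith
  have hhA : h ≤ 4 * π * A / L := by
    rw [le_div_iff₀ hLr]
    rw [div_le_iff₀ (by positivity)] at hAge
    linarith
  -- along the walk the energies lie in `[0, 4π(j+1)/L]`
  have hwalk : ∀ j ∈ Finset.range (R + 1),
      0 ≤ g (n₀ + j) ∧ g (n₀ + j) ≤ 4 * π * (j + 1) / L := by
    intro j hj
    rw [Finset.mem_range] at hj
    obtain ⟨hb1, hb2⟩ :=
      cooperRow_walk_bounds (c := c) hs hs1 hL hn₀L hcos hRle hg0 hg1 (j := j) (by omega)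
    rw [← hg (n₀ + j)] at hb1 hb2
    exact ⟨le_trans (by positivity) hb1, hb2⟩
  -- the walk lies in the summation range
  have hsub : (Finset.range (R + 1)).image (fun j => n₀ + j) ⊆ Finset.range L := by
    intro n hn
    rw [Finset.mem_image] at hn
    obtain ⟨j, hj, rfl⟩ := hn
    rw [Finset.mem_range] at hj ⊢
    have hjR : (j : ℝ) ≤ R := by exact_mod_cast Nat.lt_succ_iff.mp hj
    have hjL : (j : ℝ) ≤ L / 64 := by
      calc (j : ℝ) ≤ R := hjR
        _ ≤ s ^ 2 * L / 64 := hRle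
        _ ≤ 1 * L / 64 := by gcongr; nlinarith
        _ = L / 64 := by ring
    have h2n : 2 * (n₀ : ℝ) ≤ L := by exact_mod_cast hn₀L
    have : (n₀ : ℝ) + j < L := by linarith
    exact_mod_cast this
  have hinj : Set.InjOn (fun j => n₀ + j) ↑(Finset.range (R + 1)) := fun a _ b _ h => by
    simpa using h
  -- the harmonic sum against the logarithm
  have hharm : Real.log (1 / h) / 2 ≤ ∑ j ∈ Finset.range (R + 1), 1 / ((j : ℝ) + 1 + A) := by
    have h1 := log_sub_log_le_sum_Ico_one_div (a := A + 1) (c := A + R + 2) (by omega) (by omega)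
    rw [Finset.sum_Ico_eq_sum_range, show A + R + 2 - (A + 1) = R + 1 by omega] at h1
    have h2 : ∑ k ∈ Finset.range (R + 1), (1 : ℝ) / ((A + 1 + k : ℕ) : ℝ) =
        ∑ j ∈ Finset.range (R + 1), 1 / ((j : ℝ) + 1 + A) :=
      Finset.sum_congr rfl fun j _ => by push_cast; ring
    have h3 : Real.log (s ^ 2 * L / 64) ≤ Real.log ((A + R + 2 : ℕ) : ℝ) := by
      apply Real.log_le_log (by positivity)
      push_cast
      linarith [(Nat.cast_nonneg A : (0 : ℝ) ≤ A)]
    have h4 : Real.log ((A + 1 : ℕ) : ℝ) ≤ Real.log (h * L / (2 * π)) := by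
      apply Real.log_le_log (by positivity)
      push_cast
      have : h * L / (2 * π) = 2 * (h * L / (4 * π)) := by ring
      linarith
    have h5 : Real.log (s ^ 2 * L / 64) - Real.log (h * L / (2 * π)) =
        Real.log (π * s ^ 2 / 32) + Real.log (1 / h) := by
      rw [← Real.log_div (by positivity) (by positivity),
        ← Real.log_mul (by positivity) (by positivity)]
      congr 1
      field_simp
      ring
    have h6 : -Real.log (1 / h) / 2 < Real.log (π * s ^ 2 / 32) := by
      have := Real.log_lt_log hh hhq
      rw [Real.log_pow] at this
      rw [one_div, Real.log_inv]
      push_cast at this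
      linarith
    linarith [h1.trans (le_of_eq h2)]
  -- the chain
  calc κ ^ 2 * L / (2 * π) * Real.log (1 / h)
      = κ ^ 2 * L / π * (Real.log (1 / h) / 2) := by ring
    _ ≤ κ ^ 2 * L / π * ∑ j ∈ Finset.range (R + 1), 1 / ((j : ℝ) + 1 + A) :=
        mul_le_mul_of_nonneg_left hharm (by positivity)
    _ = ∑ j ∈ Finset.range (R + 1), κ ^ 2 * L / π * (1 / ((j : ℝ) + 1 + A)) := by
        rw [Finset.mul_sum]
    _ ≤ ∑ j ∈ Finset.range (R + 1), (w (n₀ + j)) ^ 2 / Real.sqrt ((g (n₀ + j)) ^ 2 + h ^ 2) := by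
        refine Finset.sum_le_sum fun j hj => ?_
        obtain ⟨h1, h2⟩ := hwalk j hj
        have hwj := hw (n₀ + j) h1
        set D : ℝ := 4 * π * ((j : ℝ) + 1 + A) / L with hD
        have hDpos : 0 < D := by positivity
        have hsqrt_pos : 0 < Real.sqrt ((g (n₀ + j)) ^ 2 + h ^ 2) := Real.sqrt_pos.2 (by positivity)
        have hsqrt_le : Real.sqrt ((g (n₀ + j)) ^ 2 + h ^ 2) ≤ D := by
          calc Real.sqrt ((g (n₀ + j)) ^ 2 + h ^ 2)
              ≤ Real.sqrt ((g (n₀ + j) + h) ^ 2) := Real.sqrt_le_sqrt (by nlinarith)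
            _ = g (n₀ + j) + h := Real.sqrt_sq (by positivity)
            _ ≤ 4 * π * (j + 1) / L + 4 * π * A / L := add_le_add h2 hhA
            _ = D := by rw [hD]; ring
        rw [show κ ^ 2 * L / π * (1 / ((j : ℝ) + 1 + A)) = 4 * κ ^ 2 / D by
          rw [hD]; field_simp]
        rw [div_le_div_iff₀ hDpos hsqrt_pos]
        exact mul_le_mul hwj hsqrt_le (Real.sqrt_nonneg _) (sq_nonneg _)
    _ = ∑ n ∈ (Finset.range (R + 1)).image (fun j => n₀ + j),
          (w n) ^ 2 / Real.sqrt ((g n) ^ 2 + h ^ 2) := by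
        rw [Finset.sum_image hinj]
    _ ≤ ∑ n ∈ Finset.range L, (w n) ^ 2 / Real.sqrt ((g n) ^ 2 + h ^ 2) :=
        Finset.sum_le_sum_of_subset_of_nonneg hsub fun _ _ _ => by positivity

/-! ### Dictionary: the torus objects in coordinates -/

/-- The band energy of the momentum `(a, b)` in coordinates:
`ε_L(a, b) = -2cos(2πa/L) - 2cos(2πb/L)` (a private copy of a tree dictionary lemma). [folklore] -/
private theorem dWaveCooper_torusBand_vecCons {L : ℕ} (a b : ZMod L) :
    torusBand L ![a, b] =
      -2 * Real.cos (2 * π * (a.val : ℝ) / L) - 2 * Real.cos (2 * π * (b.val : ℝ) / L) := by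
  simp only [torusBand, latticeMomentum, Fin.sum_univ_two, Matrix.cons_val_zero,
    Matrix.cons_val_one]
  ring

/-- The `d`-wave form factor of the momentum `(a, b)` in coordinates:
`ĝ_d(a, b) = cos(2πa/L) - cos(2πb/L)` (a private copy of a tree dictionary lemma). [folklore] -/
private theorem dWaveCooper_dWaveGap_vecCons {L : ℕ} (a b : ZMod L) :
    dWaveGap ![a, b] = Real.cos (2 * π * (a.val : ℝ) / L) - Real.cos (2 * π * (b.val : ℝ) / L) := by
  simp only [dWaveGap, latticeMomentum, Matrix.cons_val_zero, Matrix.cons_val_one]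

/-! ### One antinodal row of the torus -/

/-- **One antinodal row of the torus.** If `0 < κ`, `8κ - 4 ≤ μ`, `s² ≤ 12κ`, `s² ≤ -2μ`
(`0 < s ≤ 1`, `L ≥ 400/s²`), `0 < h < (πs²/32)²`, `L ≥ 8π/h`, then every row `k₂ = b` with
`cos(2πb/L) ≥ 1 - κ` carries `κ²L log(1/h)/(2π)` of the weighted regulated Cooper sum
`Σ_a ĝ_d(a,b)²/√((ε_L(a,b) - μ)² + h²)`: the row is good (`|2cos(2πb/L) + μ| ≤ 2 - s²/2`) and
`ĝ_d ≤ -2κ` wherever `ε_L ≥ μ` on it. [cite: Salmhofer1999, §4.5.4] -/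
theorem dWaveCooper_torusRow_sum_ge {L : ℕ} [NeZero L] {κ s μ h : ℝ} (hκ : 0 < κ)
    (hκμ : 8 * κ - 4 ≤ μ) (hs : 0 < s) (hs1 : s ≤ 1) (hsκ : s ^ 2 ≤ 12 * κ)
    (hsμ : s ^ 2 ≤ -2 * μ) (hh : 0 < h) (hhq : h < (π * s ^ 2 / 32) ^ 2)
    (hL : 400 / s ^ 2 ≤ (L : ℝ)) (hLh : 8 * π / h ≤ (L : ℝ)) (b : ZMod L)
    (hb : 1 - κ ≤ Real.cos (2 * π * (b.val : ℝ) / L)) :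
    κ ^ 2 * L / (2 * π) * Real.log (1 / h) ≤
      ∑ a : ZMod L, dWaveGap ![a, b] ^ 2 / Real.sqrt ((torusBand L ![a, b] - μ) ^ 2 + h ^ 2) := by
  set C₂ : ℝ := Real.cos (2 * π * (b.val : ℝ) / L) with hC₂
  have hC₂1 : C₂ ≤ 1 := Real.cos_le_one _
  set c : ℝ := -2 * C₂ - μ with hc
  have hc' : |c| ≤ 2 - s ^ 2 / 2 := by
    rw [abs_le]
    constructor <;> linarith
  have key := dWaveCooperRow_sum_ge (κ := κ) (fun n : ℕ => -2 * Real.cos (2 * π * (n : ℝ) / L) + c)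
    (fun n : ℕ => Real.cos (2 * π * (n : ℝ) / L) - C₂) (fun n => rfl) hs hs1 hc' hL hh hhq hLh ?_
  · refine key.trans (le_of_eq ?_)
    refine Finset.sum_nbij (fun n : ℕ => (n : ZMod L)) (fun n _ => Finset.mem_univ _) ?_ ?_ ?_
    · intro n hn m hm h
      have hn' : n < L := by simpa using hn
      have hm' : m < L := by simpa using hm
      have := congrArg ZMod.val h
      rwa [ZMod.val_cast_of_lt hn', ZMod.val_cast_of_lt hm'] at this
    · intro a _
      exact ⟨a.val, by simpa using ZMod.val_lt a, ZMod.natCast_zmod_val a⟩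
    · intro n hn
      have hn' : n < L := by simpa using hn
      have e : -2 * Real.cos (2 * π * (n : ℝ) / L) + c =
          -2 * Real.cos (2 * π * (n : ℝ) / L) - 2 * C₂ - μ := by rw [hc]; ring
      simp only [dWaveCooper_torusBand_vecCons, dWaveCooper_dWaveGap_vecCons, ZMod.val_cast_of_lt hn', e, hC₂]
  · intro n hgn
    have h1 : Real.cos (2 * π * (n : ℝ) / L) - C₂ ≤ -2 * κ := by
      simp only [hc] at hgn
      linarith
    nlinarith

/-! ### Assembly over the antinodal rows -/

/-- **The `d`-wave Cooper logarithm on the torus, quantitative form.** Under the hypotheses of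
`dWaveCooper_torusRow_sum_ge` and `κ ≤ ½`, the rows `b < κL/(2π) + 1` (at least `κL/(2π)` of them,
all with `cos(2πb/L) ≥ 1 - κ²/2 ≥ 1 - κ`) give
`Σ_k ĝ_d(k)²/√((ε_L(k) - μ)² + h²) ≥ κ³/(4π²) · log(1/h) · L²`. [cite: Salmhofer1999, §4.5.4] -/
theorem dWaveCooper_torus_sum_ge {L : ℕ} [NeZero L] {κ s μ h : ℝ} (hκ : 0 < κ) (hκ1 : κ ≤ 1 / 2)
    (hκμ : 8 * κ - 4 ≤ μ) (hs : 0 < s) (hs1 : s ≤ 1) (hsκ : s ^ 2 ≤ 12 * κ)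
    (hsμ : s ^ 2 ≤ -2 * μ) (hh : 0 < h) (hhq : h < (π * s ^ 2 / 32) ^ 2)
    (hL : 400 / s ^ 2 ≤ (L : ℝ)) (hLh : 8 * π / h ≤ (L : ℝ)) :
    κ ^ 3 / (4 * π ^ 2) * Real.log (1 / h) * (L : ℝ) ^ 2 ≤
      ∑ k : TorusSite 2 L, dWaveGap k ^ 2 / Real.sqrt ((torusBand L k - μ) ^ 2 + h ^ 2) := by
  have hπ := Real.pi_pos
  have hπ3 := Real.pi_gt_three
  have hLr : (0 : ℝ) < L := by exact_mod_cast Nat.pos_of_ne_zero (NeZero.ne L)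
  -- `h < 1`, so `log(1/h) ≥ 0`
  have hq1 : π * s ^ 2 / 32 < 1 := by
    have hs2 : s ^ 2 ≤ 1 := by nlinarith
    nlinarith [Real.pi_lt_four]
  have hh1 : h ≤ 1 := by
    have : (π * s ^ 2 / 32) ^ 2 < 1 := by
      have hq0 : 0 < π * s ^ 2 / 32 := by positivity
      nlinarith
    linarith
  have hlog : 0 ≤ Real.log (1 / h) := Real.log_nonneg (by rw [le_div_iff₀ hh]; linarith)
  -- the antinodal rows
  set G : Finset ℕ := Finset.range (⌊κ * L / (2 * π)⌋₊ + 1) with hG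
  have hGcard : κ * L / (2 * π) ≤ (G.card : ℝ) := by
    rw [hG, Finset.card_range]
    push_cast
    exact (Nat.lt_floor_add_one _).le
  have hGle : ∀ n ∈ G, (n : ℝ) ≤ κ * L / (2 * π) := by
    intro n hn
    rw [hG, Finset.mem_range] at hn
    have h1 := Nat.floor_le (show 0 ≤ κ * L / (2 * π) by positivity)
    have h2 : (n : ℝ) ≤ ⌊κ * L / (2 * π)⌋₊ := by exact_mod_cast Nat.lt_succ_iff.mp hn
    linarith
  have hGlt : ∀ n ∈ G, n < L := by
    intro n hn
    have h1 := hGle n hn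
    have h2 : κ * L / (2 * π) < L := by
      rw [div_lt_iff₀ (by positivity)]
      nlinarith
    exact_mod_cast h1.trans_lt h2
  have hGcos : ∀ n ∈ G, 1 - κ ≤ Real.cos (2 * π * (n : ℝ) / L) := by
    intro n hn
    have h1 := hGle n hn
    have hθ : 2 * π * (n : ℝ) / L ≤ κ := by
      rw [div_le_iff₀ hLr]
      rw [le_div_iff₀ (by positivity)] at h1
      linarith
    have hθ0 : 0 ≤ 2 * π * (n : ℝ) / L := by positivity
    have := Real.one_sub_sq_div_two_le_cos (x := 2 * π * (n : ℝ) / L)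
    nlinarith
  set GB : Finset (ZMod L) := G.image fun n : ℕ => (n : ZMod L) with hGB
  have hinj : Set.InjOn (fun n : ℕ => (n : ZMod L)) ↑G := by
    intro n hn m hm h
    have := congrArg ZMod.val h
    rwa [ZMod.val_cast_of_lt (hGlt n hn), ZMod.val_cast_of_lt (hGlt m hm)] at this
  have hGBcard : (GB.card : ℝ) = G.card := by
    rw [hGB, Finset.card_image_of_injOn hinj]
  -- the momentum-space function
  set F : TorusSite 2 L → ℝ := fun k =>
    dWaveGap k ^ 2 / Real.sqrt ((torusBand L k - μ) ^ 2 + h ^ 2) with hF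
  have hFnn : ∀ k, 0 ≤ F k := fun k => by positivity
  have hrow : ∀ b ∈ GB, κ ^ 2 * L / (2 * π) * Real.log (1 / h) ≤ ∑ a : ZMod L, F ![a, b] := by
    intro b hb
    rw [hGB, Finset.mem_image] at hb
    obtain ⟨n, hn, rfl⟩ := hb
    apply dWaveCooper_torusRow_sum_ge hκ hκμ hs hs1 hsκ hsμ hh hhq hL hLh
    rw [ZMod.val_cast_of_lt (hGlt n hn)]
    exact hGcos n hn
  -- the chain
  calc κ ^ 3 / (4 * π ^ 2) * Real.log (1 / h) * (L : ℝ) ^ 2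
      = (κ * L / (2 * π)) * (κ ^ 2 * L / (2 * π) * Real.log (1 / h)) := by ring
    _ ≤ (GB.card : ℝ) * (κ ^ 2 * L / (2 * π) * Real.log (1 / h)) := by
        rw [hGBcard]
        exact mul_le_mul_of_nonneg_right hGcard (mul_nonneg (by positivity) hlog)
    _ = ∑ b ∈ GB, κ ^ 2 * L / (2 * π) * Real.log (1 / h) := by
        rw [Finset.sum_const, nsmul_eq_mul]
    _ ≤ ∑ b ∈ GB, ∑ a : ZMod L, F ![a, b] := Finset.sum_le_sum hrow
    _ ≤ ∑ b : ZMod L, ∑ a : ZMod L, F ![a, b] :=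
        Finset.sum_le_sum_of_subset_of_nonneg (Finset.subset_univ _) fun b _ _ =>
          Finset.sum_nonneg fun a _ => hFnn _
    _ = ∑ k, F k := (sum_torusSite_two_eq F).symm

/-! ### The stub -/

/-- **The `d`-wave-weighted zero-temperature Cooper logarithm on the torus.** For chemical potentials
in a compact `[μ₁, μ₂] ⊂ (-4, 0)` (Fermi curve off the band edges and off the van Hove energy) there
are `c, h₀ > 0` such that for every `h ∈ (0,h₀)` and `μ ∈ [μ₁,μ₂]`, eventually in `L`,
`Σ_{k ∈ (ℤ/Lℤ)²} ĝ_d(k)² / √((ε_L(k) - μ)² + h²) ≥ c · log(1/h) · L²`. Here `c = κ³/(4π²)`,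
`κ = (4 + μ₁)/8`, `h₀ = (πs²/32)²`, `s = κ(-μ₂)/4`, `L₀ = ⌈max(400/s², 8π/h)⌉` (row walk over the
antinodal rows, `dWaveCooper_torus_sum_ge`). [cite: Salmhofer1999, §4.5.4] -/
theorem stub_dWaveCooperSumLowerBound :
    ∀ μ₁ μ₂ : ℝ, -4 < μ₁ → μ₁ ≤ μ₂ → μ₂ < 0 → ∃ c : ℝ, 0 < c ∧ ∃ h₀ : ℝ, 0 < h₀ ∧
      ∀ h ∈ Set.Ioo 0 h₀, ∀ μ ∈ Set.Icc μ₁ μ₂, ∃ L₀ : ℕ, ∀ (L : ℕ) [NeZero L], L₀ ≤ L →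
        c * Real.log (1 / h) * (L : ℝ) ^ 2 ≤
          ∑ k : TorusSite 2 L, dWaveGap k ^ 2 / Real.sqrt ((torusBand L k - μ) ^ 2 + h ^ 2) := by
  intro μ₁ μ₂ hμ₁ hμ₁₂ hμ₂
  have hπ := Real.pi_pos
  set κ : ℝ := (4 + μ₁) / 8 with hκ
  have hκ0 : 0 < κ := by rw [hκ]; linarith
  have hκ1 : κ ≤ 1 / 2 := by rw [hκ]; linarith
  set s : ℝ := κ * -μ₂ / 4 with hs
  have hμ₂' : 0 < -μ₂ := by linarith
  have hs0 : 0 < s := by rw [hs]; positivity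
  have hsκ' : s ≤ κ := by
    rw [hs]
    have : -μ₂ < 4 := by linarith
    nlinarith
  have hsμ' : s ≤ -μ₂ / 8 := by rw [hs]; nlinarith
  have hs1 : s ≤ 1 := by linarith
  have hss : s ^ 2 ≤ s := by nlinarith
  refine ⟨κ ^ 3 / (4 * π ^ 2), by positivity, (π * s ^ 2 / 32) ^ 2, by positivity, ?_⟩
  intro h hh μ hμ
  refine ⟨⌈max (400 / s ^ 2) (8 * π / h)⌉₊, fun L _ hL => ?_⟩
  have hL' : max (400 / s ^ 2) (8 * π / h) ≤ (L : ℝ) := Nat.ceil_le.mp hL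
  exact dWaveCooper_torus_sum_ge hκ0 hκ1 (by rw [hκ]; linarith [hμ.1]) hs0 hs1 (by nlinarith)
    (by nlinarith [hμ.2]) hh.1 hh.2 ((le_max_left _ _).trans hL') ((le_max_right _ _).trans hL')

end Summit.HubbardSuperconductivity.HubbardSuperconductivity.Theorems
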